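import Literature.NumberTheory.DiophantineGeometry.SmallMultiplicativeRelation
import Literature.NumberTheory.DiophantineGeometry.KummerConditionSaturated
import HarnessLib

/-!
# The index of the exponent lattice in its saturation is bounded by the heights

Topic `NumberTheory/DiophantineGeometry`; namespace `Literature.NumberTheory.DiophantineGeometry.Dioph`.
Theorems only; no definition, no named fact.

Matveev's construction for linear forms in `n` logarithms of positive rationals `α₁, …, αₙ`
(Yu. V. Nesterenko, *Linear forms in logarithms of rational numbers*, LNM 1819 (2003), §3.4) runs on
the lattice `𝔑 = {λ ∈ ℚⁿ : α^λ ∈ ℚ} ⊇ ℤⁿ` and pays the index `N = [𝔑 : ℤⁿ]` only through `log N`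
(the number of Kummer levels `S = n + 24 + [log₂ N]`, the parameter `X ∝ log(eBN)`, the Siegel
weights `(16^{n+8.4} N)^{L₀−ℓ₀}`, p. 107); print bounds it by Prop. 3.7, `N ≤ 2n(2e)ⁿ ∏ Aⱼ`
(Brunn–Minkowski, Blichfeldt and an interpolation determinant). In the tree's vocabulary
(`KummerSaturated.exists_saturated_basis_rat`: a saturated basis `θ` with `αⱼ = ∏ᵢ θᵢ^{C j i}`, so that
`𝔑 = C^{-T} ℤⁿ` and `N = |det C|`) this file proves the ELEMENTARY bound that suffices for every
`∃c`-shaped consumer: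

* `natAbs_det_le_prod_height` — for positive multiplicatively independent `θ` and ANY integer matrix
  `C` with `αⱼ = ∏ᵢ θᵢ^{C j i}`: `|det C| ≤ ∏ⱼ (2 h(αⱼ) / log 2)`.
  Proof: the valuation matrix of `α` is `C` times that of `θ`; the latter has a non-singular `n × n`
  minor (independence of `θ`; `exists_rows_det_ne_zero`), the corresponding minor of the former is
  `det C` times a non-zero integer, and is at most `∏ⱼ ∑_q |ord_q αⱼ| ≤ ∏ⱼ 2h(αⱼ)/log 2` by
  Hadamard's `ℓ¹` inequality (`abs_det_le_prod_sum_abs`, `sum_abs_padicValRat_le`).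
* `exists_saturated_basis_rat_det_le` — the saturated basis of `exists_saturated_basis_rat` with the
  change-of-basis matrix and this bound packaged.

WHAT THIS IS NOT: not Nesterenko's Prop. 3.7 (constant `2n(2e)ⁿ`); not a statement about any frame.

## References

* [Nesterenko2003] Yu. V. Nesterenko, *Linear forms in logarithms of rational numbers*, LNM 1819
  (2003) — §3.4, Prop. 3.7 (p. 105–106) and p. 107 (where `N` enters).
-/

noncomputable section

open Finset Matrix Height

namespace Literature.NumberTheory.DiophantineGeometry.Dioph

/-- Clearing denominators in a rational relation: for `g : ι → ℚ` there are `d ∈ ℕ`, `d ≠ 0`, and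
`z : ι → ℤ` with `g i * d = z i`. [folklore] -/
private theorem exists_int_mul_eq {ι : Type*} [Fintype ι] (g : ι → ℚ) :
    ∃ (d : ℕ) (z : ι → ℤ), d ≠ 0 ∧ ∀ i, g i * d = z i := by
  classical
  refine ⟨∏ i, (g i).den, fun i => (g i).num * ((∏ k, (g k).den) / (g i).den : ℕ), ?_, ?_⟩
  · exact Finset.prod_ne_zero_iff.mpr fun i _ => (g i).den_nz
  · intro i
    obtain ⟨e, he⟩ : (g i).den ∣ ∏ k, (g k).den :=
      Finset.dvd_prod_of_mem (fun k => (g k).den) (Finset.mem_univ i)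
    dsimp only
    rw [he, Nat.mul_div_cancel_left e (g i).den_pos]
    push_cast
    rw [← mul_assoc, Rat.mul_den_eq_num]

/-- **The columns of the valuation matrix of a multiplicatively independent family of positive
rationals are linearly independent over `ℚ`** (equivalently: Nesterenko's `𝔑` is a full lattice).
[cite: Nesterenko2003, §3.4 (p. 105)] -/
theorem linearIndependent_padicValRat_cols {n : ℕ} {P : Finset ℕ} (hP : ∀ p ∈ P, p.Prime)
    {θ : Fin n → ℚ} (hθ : ∀ i, 0 < θ i) (hunit : ∀ i, IsPUnit P (θ i))
    (hind : ∀ μ : Fin n → ℤ, ∏ i, θ i ^ μ i = 1 → μ = 0) :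
    LinearIndependent ℚ (Matrix.of fun (q : P) (i : Fin n) => (padicValRat q (θ i) : ℚ)).col := by
  classical
  rw [Fintype.linearIndependent_iff]
  intro g hg i₀
  obtain ⟨d, z, hd, hz⟩ := exists_int_mul_eq g
  -- the integer relation
  have hrel : ∀ q : P, ∑ i, z i * padicValRat q (θ i) = 0 := by
    intro q
    have h := congrFun hg q
    simp only [Finset.sum_apply, Pi.smul_apply, smul_eq_mul, Matrix.col_apply, Matrix.of_apply,
      Pi.zero_apply] at h
    have h2 : ∑ i, (g i * d) * (padicValRat q (θ i) : ℚ) = 0 := by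
      calc ∑ i, (g i * d) * (padicValRat q (θ i) : ℚ)
          = (∑ i, g i * (padicValRat q (θ i) : ℚ)) * d := by
            rw [Finset.sum_mul]; exact Finset.sum_congr rfl fun i _ => by ring
        _ = 0 := by rw [h, zero_mul]
    simp only [hz] at h2
    exact_mod_cast h2
  -- the valuation vector of `∏ θᵢ^{zᵢ}` vanishes
  have hθ0 : ∀ i, θ i ≠ 0 := fun i => (hθ i).ne'
  have hvec : padicOrdVec P (∏ i, θ i ^ z i) = 0 := by
    rw [padicOrdVec_prod_zpow hP hθ0 z]
    funext q
    simp only [Finset.sum_apply, Pi.smul_apply, Pi.zero_apply]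
    simp only [zsmul_eq_mul, padicOrdVec]
    exact_mod_cast hrel q
  have hu : IsPUnit P (∏ i, θ i ^ z i) := IsPUnit.prod _ fun i _ => (hunit i).zpow _
  have hpos : 0 < ∏ i, θ i ^ z i := Finset.prod_pos fun i _ => zpow_pos (hθ i) _
  have hone : ∏ i, θ i ^ z i = 1 := by
    rcases eq_sign_of_padicOrdVec_eq_zero hP hu hvec with h | h
    · exact h
    · rw [h] at hpos; norm_num at hpos
  have hz0 := hind z hone
  have : g i₀ * d = 0 := by rw [hz i₀, hz0]; simp
  rcases mul_eq_zero.mp this with h | h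
  · exact h
  · exact absurd (by exact_mod_cast h) hd

/-- **The index of the exponent lattice is bounded by the heights.** If `θ₁, …, θₙ` are positive
multiplicatively independent rationals and `αⱼ = ∏ᵢ θᵢ^{C j i}` for an integer matrix `C`, then
`|det C| ≤ ∏ⱼ (2 h(αⱼ) / log 2)` (when `θ` is a basis of the saturation of `⟨α⟩`, `|det C|` is the
index `N = [𝔑 : ℤⁿ]` of Nesterenko's §3.4). [cite: Nesterenko2003, §3.4 Prop 3.7 (weaker, elementary form)] -/
theorem natAbs_det_le_prod_height {n : ℕ} {θ α : Fin n → ℚ} (hθ : ∀ i, 0 < θ i)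
    (hind : ∀ μ : Fin n → ℤ, ∏ i, θ i ^ μ i = 1 → μ = 0)
    (C : Matrix (Fin n) (Fin n) ℤ) (hC : ∀ j, α j = ∏ i, θ i ^ C j i) :
    (C.det.natAbs : ℝ) ≤ ∏ j, (2 * logHeight₁ (α j) / Real.log 2) := by
  classical
  -- a finite set of primes outside which every `θᵢ` (hence every `αⱼ`) is a unit
  set Mb := (univ : Finset (Fin n)).sup (fun i => max (θ i).num.natAbs (θ i).den) + 1 with hMb
  set P := Nat.primesBelow Mb with hPdef
  have hP : ∀ p ∈ P, p.Prime := fun p hp => (Nat.mem_primesBelow.mp hp).2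
  have hθ0 : ∀ i, θ i ≠ 0 := fun i => (hθ i).ne'
  have hunitθ : ∀ i, IsPUnit P (θ i) := by
    intro i
    have hk : max (θ i).num.natAbs (θ i).den ≤
        (univ : Finset (Fin n)).sup (fun i => max (θ i).num.natAbs (θ i).den) :=
      Finset.le_sup (f := fun i => max (θ i).num.natAbs (θ i).den) (Finset.mem_univ i)
    have hk1 : (θ i).num.natAbs ≤ max (θ i).num.natAbs (θ i).den := le_max_left _ _
    have hk2 : (θ i).den ≤ max (θ i).num.natAbs (θ i).den := le_max_right _ _
    apply isPUnit_primesBelow (hθ0 i) <;> omega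
  have hunitα : ∀ j, IsPUnit P (α j) := by
    intro j; rw [hC j]; exact IsPUnit.prod _ fun i _ => (hunitθ i).zpow _
  -- valuation matrices (rows `↥P`)
  set A : P → Fin n → ℤ := fun q i => padicValRat q (θ i) with hA
  set B : P → Fin n → ℤ := fun q j => padicValRat q (α j) with hB
  have hBA : ∀ (q : P) j, B q j = ∑ i, C j i * A q i := by
    intro q j
    have h := congrFun (padicOrdVec_prod_zpow (P := P) hP hθ0 (fun i => C j i)) q
    rw [← hC j] at h
    simp only [Finset.sum_apply, Pi.smul_apply] at h
    simp only [zsmul_eq_mul, padicOrdVec] at h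
    show padicValRat q (α j) = ∑ i, C j i * padicValRat q (θ i)
    exact_mod_cast h
  -- a non-singular `n × n` minor of `A`
  set Aq : Matrix P (Fin n) ℚ := Matrix.of fun q i => (A q i : ℚ) with hAq
  have hcol : LinearIndependent ℚ Aq.col := linearIndependent_padicValRat_cols hP hθ hunitθ hind
  obtain ⟨f, hf, hdet⟩ := exists_rows_det_ne_zero Aq hcol
  set MA : Matrix (Fin n) (Fin n) ℤ := Matrix.of fun i k => A (f i) k with hMA
  set MB : Matrix (Fin n) (Fin n) ℤ := Matrix.of fun i j => B (f i) j with hMB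
  have hMAq : (Matrix.of fun i j => Aq (f i) j) = MA.map (Int.castRingHom ℚ) := by
    ext i j; rfl
  have hdetA : MA.det ≠ 0 := by
    intro h0
    apply hdet
    rw [hMAq, ← RingHom.mapMatrix_apply, ← RingHom.map_det, h0, map_zero]
  -- `MB = MA * Cᵀ`
  have hMBeq : MB = MA * C.transpose := by
    ext i j
    simp only [hMB, hMA, Matrix.of_apply, Matrix.mul_apply, Matrix.transpose_apply, hBA]
    exact Finset.sum_congr rfl fun l _ => mul_comm _ _
  have hdetB : MB.det = MA.det * C.det := by rw [hMBeq, Matrix.det_mul, Matrix.det_transpose]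
  -- `|det C| ≤ |det MB|`
  have h1 : |C.det| ≤ |MB.det| := by
    rw [hdetB, abs_mul]
    have hA1 : 1 ≤ |MA.det| := Int.one_le_abs hdetA
    nlinarith [abs_nonneg C.det]
  -- Hadamard and the height bound
  have h2 : |MB.det| ≤ ∏ j, ∑ i, |MB i j| := abs_det_le_prod_sum_abs MB
  have h3 : ∏ j, ∑ i, |MB i j| ≤ ∏ j, ∑ q : P, |B q j| := by
    refine Finset.prod_le_prod (fun j _ => Finset.sum_nonneg fun i _ => abs_nonneg _) fun j _ => ?_
    simp only [hMB, Matrix.of_apply]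
    exact sum_comp_le_sum_of_injective hf (fun q => |B q j|) fun q => abs_nonneg _
  have hN : ∀ j, ((∑ q : P, |B q j| : ℤ) : ℝ) ≤ 2 * logHeight₁ (α j) / Real.log 2 := by
    intro j
    have := sum_abs_padicValRat_le hP (hunitα j)
    push_cast [hB]
    exact this
  calc (C.det.natAbs : ℝ) = ((|C.det| : ℤ) : ℝ) := Nat.cast_natAbs _
    _ ≤ ((∏ j, ∑ q : P, |B q j| : ℤ) : ℝ) := by exact_mod_cast h1.trans (h2.trans h3)
    _ = ∏ j, ((∑ q : P, |B q j| : ℤ) : ℝ) := by push_cast; rfl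
    _ ≤ ∏ j, (2 * logHeight₁ (α j) / Real.log 2) :=
        Finset.prod_le_prod (fun j _ => by positivity) fun j _ => hN j

/-- **Saturated basis with index bound.** For positive multiplicatively independent rationals
`α₁, …, αₙ` there is a positive independent family `θ₁, …, θₙ`, saturated up to sign
(`γ^q ∈ ⟨θ⟩ ⇒ ±γ ∈ ⟨θ⟩`), and an integer matrix `C` with `αⱼ = ∏ᵢ θᵢ^{C j i}` and
`|det C| ≤ ∏ⱼ (2 h(αⱼ) / log 2)` — the exponent lattice `𝔑 = C^{-T}ℤⁿ` of Nesterenko §3.4 with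
`N = [𝔑 : ℤⁿ] = |det C|` so bounded (`KummerSaturated.exists_saturated_basis_rat` +
`natAbs_det_le_prod_height`). [cite: Nesterenko2003, §3.4 (p. 105), Prop 3.7 (weaker, elementary form)] -/
theorem exists_saturated_basis_rat_det_le {n : ℕ} (α : Fin n → ℚ) (hα : ∀ j, 0 < α j)
    (hind : ∀ μ : Fin n → ℤ, ∏ j, α j ^ μ j = 1 → μ = 0) :
    ∃ (θ : Fin n → ℚ) (C : Matrix (Fin n) (Fin n) ℤ), (∀ i, 0 < θ i) ∧
      (∀ μ : Fin n → ℤ, ∏ i, θ i ^ μ i = 1 → μ = 0) ∧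
      (∀ j, α j = ∏ i, θ i ^ C j i) ∧
      (∀ q : ℕ, 0 < q → ∀ γ : ℚ, (∃ c : Fin n → ℤ, γ ^ q = ∏ i, θ i ^ c i) →
        ∃ c : Fin n → ℤ, γ = ∏ i, θ i ^ c i ∨ -γ = ∏ i, θ i ^ c i) ∧
      (C.det.natAbs : ℝ) ≤ ∏ j, (2 * logHeight₁ (α j) / Real.log 2) := by
  obtain ⟨θ, hθ, hθind, hrep, hsat, -⟩ := KummerSaturated.exists_saturated_basis_rat α hα hind
  choose c hc using hrep
  refine ⟨θ, Matrix.of fun j i => c j i, hθ, hθind, fun j => ?_, hsat, ?_⟩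
  · simp only [Matrix.of_apply]; exact hc j
  · exact natAbs_det_le_prod_height hθ hθind _ fun j => by simp only [Matrix.of_apply]; exact hc j

end Literature.NumberTheory.DiophantineGeometry.Dioph

end
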